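/-
Copyright (c) 2026 the pub-hodgecm-mathlib formalisation cell (harness21).  Prover seat hodgecm-mathlib-K2E2-p12 (g9), Track B «K2-LIT», h413 = `stmt-HodgeConjecture-24833`,
R90-TF section S8 «ContSpec-n½», deal S8-R126 (2) «T1 FILE 3» (S8 dealer R90-CS-plan (g2); census `K2/K2E2-p12/g9/CENSUS-ChiTruncBounded3.md` 810c14bee931cf6e): the truncated LEVEL ∕
`(χ₁, χ₂)`-PAIR Eisenstein series of `U(2,1)_{L∕L⁺}` is BOUNDED on `G(𝔸)` for `Re z > 2`, `T ≥ 1` — UNCONDITIONALLY, by domination — and the CM Maass–Selberg relation ★ final′ loses its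
decay letter `hdec′` (ED. 3).
-/
import Summits.HodgeConjecture.HodgeConjecture.Theorems.K2E1MaassSelbergCMThreeFinal                     -- ★ final′ (ED. 2) `maassSelberg_flatSectionU_cm_three_final'` and its ★ inputs (ED. 7 `maassSelberg_flatSectionU_three_pair`, ★ `K2E1TruncatedEisensteinBoundedCMThree`, ★ binders, ★ (ν-2))
import Summits.HodgeConjecture.HodgeConjecture.Theorems.K2E1MaassSelbergPairingCMThree                   -- ★ §C `exists_bound_sub_borelConstantTerm_sphericalEisenstein_cm_three_free` (the SPHERICAL cusp decay, every letter discharged)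
import Summits.HodgeConjecture.HodgeConjecture.Theorems.K2E1TruncatedEisensteinCuspOrthogonalCMThree     -- ★ 3a₃ `exists_tsum_enorm_lowIndicator_le_cm_three` (the DOMINATION of the low part by the spherical truncation); brings `siegel_three`, ★ `norm_eisensteinSeriesU_indicator_lt_le`
import Summits.HodgeConjecture.HodgeConjecture.Theorems.K2E1EisensteinConstantTermIntertwinedBoundLevelU3 -- ★ p863071 (this seat): `exists_bound_norm_borelConstantTerm_sub_flatSectionU_cm_three` (the tail `E_B(E f_z) − f_z` is bounded above the floor); brings ★ `IsChiSectionPair`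
import Literature.NumberTheory.Automorphic.UnitaryGroupBorelConstantTermInvariance                       -- ★ `borelConstantTerm_rational_borel_mul_of_rational_invariant` (`E_B` is left-`B(L⁺)`-invariant)
import HarnessLib

/-!
# K2·E1 ∕ R90·S8 — `K2E1ChiTruncatedEisensteinBoundedCMThree` (T1 FILE 3, re-cut): **`Λ^T E(φH^z)` IS BOUNDED ON `U(2,1)(𝔸)` FOR EVERY LEVEL ∕ PAIR SECTION `φ`, `Re z > 2`, `T ≥ 1` —
# FREE — AND THE CM MAASS–SELBERG RELATION ★ final′ WITHOUT ITS DECAY LETTER `hdec′` (ED. 3)**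

Cell `pub/hodgecm-mathlib`, crux h413 = `stmt-HodgeConjecture-24833`, route of record `HCCMUnconditional`; R90-TF section S8 «ContSpec-n½», the `hMStube` chain of ★ p862892 (K2E1-p16's T1:
the χ Maass–Selberg inner-product formula on the tube at `N = 3`).  THEOREMS ONLY (no `def`, no `instance`, no notation, no named-fact hypothesis, no `sorry`; default heartbeats); lane
`--supports stmt-HodgeConjecture-24833 --as helper` (count-neutral).  Closes no socket.

WHY THIS FILE AND NOT «the `hdec′` χ-twin».  ★ final′ `maassSelberg_flatSectionU_cm_three_final'` names ONE analytic input besides the `K_U`-averages: the cusp decay `hdec′ : ‖E(f′_{z′}) −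
E(f′_{z′})_B‖ ≤ M₁` on `{H > T}`.  For a general continuous bounded section that decay is the [D2] Poisson chain, hypothesis-first on archimedean smoothness (`hφarchZ`), paid ★ only for
CONSTANT sections (★ (E-d) ⇒ ★ `exists_bound_sub_borelConstantTerm_sphericalEisenstein_cm_three_free`).  But final′ USES `hdec′` in exactly one place: to produce the sup bound `hΛbdd : ‖Λ^T
E(f′_{z′})‖ ≤ M` that ★ ED. 7 `maassSelberg_flatSectionU_three_pair` consumes.  And `hΛbdd` is FREE for every level section, by DOMINATION ([MoeglinWaldspurger1995, I.2.13, II.1.7];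
[Arthur1980TraceFormulaII, Lemma 1.4]): on the tube the truncated series splits POINTWISE, `Λ^T E(f_z) = E(𝟙_{H≤T} f_z) − E(𝟙_{H>T} Mf)` with the tail `Mf := E_B(E f_z) − f_z` (★
`truncation_eisensteinSeriesU_eq_three`); the low part is dominated termwise by the constant section `(M:ℂ)` (`‖φ‖ ≤ M`), `Σ_q ‖𝟙_{H≤T}(M)H^z(q̃y)‖ ≤ ‖Λ^T E((M:ℂ)H^{Re z})(y)‖ + C` (★ 3a₃
`exists_tsum_enorm_lowIndicator_le_cm_three`), where the SPHERICAL truncation is bounded free (★ `…sphericalEisenstein_cm_three_free` + ★ Arthur's lemma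
`exists_norm_truncation_eisensteinSeriesU_flatSectionU_le_cm_three`); the high part lives one coset above the floor (★ `norm_eisensteinSeriesU_indicator_lt_le siegel_three`) with `‖Mf‖ ≤ C′`
on `{T < H}` — the intertwined part of the constant term is bounded high in the cusp, ★ p863071 `exists_bound_norm_borelConstantTerm_sub_flatSectionU_cm_three` ([MoeglinWaldspurger1995] II.1.7,
Gindikin–Karpelevich ★ [D8]₃).  No Poisson summation, no archimedean letter.
* §1 **`exists_norm_truncation_eisensteinSeriesU_flatSectionU_le_level_cm_three_free`** — `∃ M′, ∀ g, ‖Λ^T E(φH^z)(g)‖ ≤ M′` for `φ` continuous, bounded, left-`N(𝔸)`∕`B(L⁺)`-invariant,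
  `2 < Re z`, `1 ≤ T` (no letters); **`…_pair_cm_three_free`** — the same for a `(χ₁, χ₂)`-pair section (★ `IsChiSectionPair`, `χ₂` automorphic).
* §2 **`memLp_quotFun_truncation_eisensteinSeriesU_flatSectionU_level_cm_three_free`** — `Λ^T E(φH^z) ∈ L^p(X, μ)` for every finite `μ` (★ R6e `memLp_quotFun_of_bound`); **`hTr_cm_three_free`** —
  the SPHERICAL (Tr) letter of ★ p863045 `tubeSeed_pair_cm_three_of_letters` ∕ ★ `…LevelCMTwo`-type heads, `∀ σ > 2, Λ^T E((M:ℂ)H^σ) ∈ L²(μ)`, token for token.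
* §3 HEAD **`maassSelberg_flatSectionU_cm_three_final_free`** (ED. 3 of ★ «CM-FINAL») — ★ final′'s statement with the binder `hdec′` DELETED and nothing added: named inputs `hΞ₁…hΞ₄` ONLY;
  proof = final′'s body with `hΛbdd` from §1.  Consumer: K2E1-p16's T1 FILE 1 head `maassSelberg_chiPair_cm_three_of_letters` re-based on ED. 3 drops `hdec′`.
HONEST LABEL: HC_CM is proved only modulo the 7 printed citations (2 remaining named inputs: hLiu418 = `stmt-HodgeConjecture-24832`, h413 = `stmt-HodgeConjecture-24833`) until rung 0
closes; this file asserts no named fact and closes no socket; §1–§2 are unconditional, §3 is conditional exactly on final′'s `K_U`-average data `hΞ₁…hΞ₄`; count-neutral.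
References: [MoeglinWaldspurger1995] I.2.13, II.1.7, IV.2.1–IV.2.3 · [Arthur1980TraceFormulaII] §1 (Lemma 1.4), §4 · [Garrett2018] §2.10–§2.11, §11.3 · [BernsteinLapid2019] §4.
-/

set_option autoImplicit false
set_option linter.dupNamespace false  -- the mandated namespace repeats the single-problem summit's segment (`HodgeConjecture.HodgeConjecture`)

noncomputable section

open MeasureTheory Measure NumberField IsDedekindDomain Set MulAction Filter Topology
open scoped ENNReal NNReal ComplexConjugate
open Literature.MeasureTheory.Group Literature.NumberTheory
open Literature.NumberTheory.Automorphic Literature.NumberTheory.Automorphic.UnitaryGroup AdelicGroupData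
open Literature.NumberTheory.Automorphic.Arthur2013.Leaves.TECR
open Literature.NumberTheory.GaloisRepresentations (HeckeCharacter)
open Summit.HodgeConjecture.HodgeConjecture.Cruxes.H413.K2E1BorelEisensteinU
open Summit.HodgeConjecture.HodgeConjecture.Cruxes.H413.K2E1MaassSelbergBracketsThree
open Summit.HodgeConjecture.HodgeConjecture.Cruxes.H413.K2E1MaassSelbergCMThree (summable_flatSectionU_cm_three)
open Summit.HodgeConjecture.HodgeConjecture.Cruxes.H413.K2E1MaassSelbergCMThreePairingsFin (maassSelberg_flatSectionU_three_pair)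
open Summit.HodgeConjecture.HodgeConjecture.Cruxes.H413.K2E1TruncatedEisensteinBoundedCMThree
open Summit.HodgeConjecture.HodgeConjecture.Cruxes.H413.K2E1TruncatedEisensteinExplicit
open Summit.HodgeConjecture.HodgeConjecture.Cruxes.H413.K2E1TruncatedEisensteinL2 (memLp_quotFun_of_bound measurable_quotFun_of_measurable)
open Summit.HodgeConjecture.HodgeConjecture.Cruxes.H413.K2E1EisensteinAnalyticBinders (hfin_of_locallyUniformMajorant integrableOn_translate_of_continuous)
open Summit.HodgeConjecture.HodgeConjecture.Cruxes.H413.K2E1BorelEisensteinGodementCMThree (exists_locallyUniform_majorant_flatSectionU_cm_three summable_eisensteinSeriesU_flatSectionU_cm_three)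
open Summit.HodgeConjecture.HodgeConjecture.Cruxes.H413.K2E1BorelEisensteinRegularCMThree (continuous_eisensteinSeriesU_flatSectionU_cm_three)
open Summit.HodgeConjecture.HodgeConjecture.Cruxes.H413.K2E1BorelCosetsDictionary (eisensteinSeriesU_eq_tsum_arithmeticBorelQuot forall_arithmeticBorel_iff)
open Summit.HodgeConjecture.HodgeConjecture.Cruxes.H413.K2E1SphericalEisensteinResidueOrthogonalU (norm_eisensteinSeriesU_indicator_lt_le)
open Summit.HodgeConjecture.HodgeConjecture.Cruxes.H413.K2E1TruncatedEisensteinCuspOrthogonalCMThree (exists_tsum_enorm_lowIndicator_le_cm_three)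
open Summit.HodgeConjecture.HodgeConjecture.Cruxes.H413.K2E1MaassSelbergPairingCMThree (exists_bound_sub_borelConstantTerm_sphericalEisenstein_cm_three_free)
open Summit.HodgeConjecture.HodgeConjecture.Cruxes.H413.K2E1EisensteinConstantTermIntertwinedBoundLevelU3 (exists_bound_norm_borelConstantTerm_sub_flatSectionU_cm_three)
open Summit.HodgeConjecture.HodgeConjecture.Cruxes.H413.K2E1CharacterEisensteinU3PairDefs

namespace Summit.HodgeConjecture.HodgeConjecture.Cruxes.H413.K2E1ChiTruncatedEisensteinBoundedCMThree

variable (L : Type) [Field L] [NumberField L] [IsCMField L]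
variable [MeasurableSpace (quasiSplit (↥(maximalRealSubfield L)) L (IsCMField.complexConj L) 3).Adelic] [BorelSpace (quasiSplit (↥(maximalRealSubfield L)) L (IsCMField.complexConj L) 3).Adelic]

/-! ## §1 `Λ^T E(φH^z)` is bounded on `G(𝔸)` for every level section — by domination, free -/

section Bound

/-- **`Λ^T E(φH^z)` IS BOUNDED ON `U(2,1)(𝔸_{L⁺})`, FREE** (`hΛbdd` for a LEVEL section): `ν` Haar on the Heisenberg radical `N(𝔸)` with a fundamental domain `𝓕` of `N(L⁺)` of compact closure,
`φ` CONTINUOUS, BOUNDED (`‖φ‖ ≤ M`), left-`N(𝔸)`- and left-`B(L⁺)`-invariant, `1 ≤ T`, `2 < Re z`: **`∃ M′, ∀ g, ‖Λ^T E(φH^z)(g)‖ ≤ M′`**.  DOMINATION: `Λ^T E(f_z) = E(𝟙_{H≤T}f_z) − E(𝟙_{H>T}Mf)`,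
`Mf := E_B(E f_z) − f_z` (★ split); `‖E(𝟙_{H≤T}f_z)(y)‖ ≤ ‖Λ^T E((M:ℂ)H^{Re z})(y)‖ + C` (★ 3a₃ domination; the spherical truncation bounded by ★ `_free` + ★ Arthur's lemma);
`‖E(𝟙_{H>T}Mf)(y)‖ ≤ max C′ 0` (one coset above the floor ★, `‖Mf‖ ≤ C′` on `{T < H}` ★ p863071). [cite: MoeglinWaldspurger1995, I.2.13, II.1.7] [cite: Arthur1980TraceFormulaII, §1 (Lemma 1.4)] -/
theorem exists_norm_truncation_eisensteinSeriesU_flatSectionU_le_level_cm_three_free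
    (ν : Measure ↥(adelicUnipotent (↥(maximalRealSubfield L)) L (IsCMField.complexConj L) 3)) [ν.IsHaarMeasure]
    {𝓕 : Set ↥(adelicUnipotent (↥(maximalRealSubfield L)) L (IsCMField.complexConj L) 3)}
    (h𝓕N : IsFundamentalDomain ↥(rationalUnipotent (↥(maximalRealSubfield L)) L (IsCMField.complexConj L) 3) 𝓕 ν) (h𝓕c : IsCompact (closure 𝓕))
    {φ : (quasiSplit (↥(maximalRealSubfield L)) L (IsCMField.complexConj L) 3).Adelic → ℂ} (hφc : Continuous φ) {M : ℝ} (hφM : ∀ x, ‖φ x‖ ≤ M)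
    (hφN : ∀ (u : ↥(adelicUnipotent (↥(maximalRealSubfield L)) L (IsCMField.complexConj L) 3)) (x : (quasiSplit (↥(maximalRealSubfield L)) L (IsCMField.complexConj L) 3).Adelic),
      φ ((u : (quasiSplit (↥(maximalRealSubfield L)) L (IsCMField.complexConj L) 3).Adelic) * x) = φ x)
    (hφB : ∀ b ∈ borelU ((IsCMField.complexConj L : L ≃ₐ[↥(maximalRealSubfield L)] L) : L →+* L) ((StdForm.antidiagonal 3).over L),
      ∀ x : (quasiSplit (↥(maximalRealSubfield L)) L (IsCMField.complexConj L) 3).Adelic,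
        φ ((quasiSplit (↥(maximalRealSubfield L)) L (IsCMField.complexConj L) 3).toAdelic b * x) = φ x)
    {T : ℝ≥0} (hT : 1 ≤ T) {z : ℂ} (hz : 2 < z.re) :
    ∃ M' : ℝ, ∀ g : (quasiSplit (↥(maximalRealSubfield L)) L (IsCMField.complexConj L) 3).Adelic, ‖truncation ν 𝓕 T (eisensteinSeriesU (flatSectionU φ z)) g‖ ≤ M' := by
  haveI := t2Space_adeleRing_of_numberField L
  haveI := locallyCompactSpace_adeleRing' L
  haveI : T2Space (quasiSplit (↥(maximalRealSubfield L)) L (IsCMField.complexConj L) 3).Adelic :=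
    inferInstanceAs (T2Space (adelic (↥(maximalRealSubfield L)) L (IsCMField.complexConj L) 3 ((StdForm.antidiagonal 3).over L)))
  -- the section, the tail `Mf := E_B(E f_z) − f_z`, the two pieces, their `B(L⁺)`-invariance, the Godement sum
  set f : (quasiSplit (↥(maximalRealSubfield L)) L (IsCMField.complexConj L) 3).Adelic → ℂ := flatSectionU φ z with hf
  set Mf : (quasiSplit (↥(maximalRealSubfield L)) L (IsCMField.complexConj L) 3).Adelic → ℂ := fun g => borelConstantTerm ν 𝓕 (eisensteinSeriesU f) g - f g with hMf
  set f₁ : (quasiSplit (↥(maximalRealSubfield L)) L (IsCMField.complexConj L) 3).Adelic → ℂ :=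
    {g : (quasiSplit (↥(maximalRealSubfield L)) L (IsCMField.complexConj L) 3).Adelic | borelHeight g ≤ T}.indicator f with hf₁
  set f₂ : (quasiSplit (↥(maximalRealSubfield L)) L (IsCMField.complexConj L) 3).Adelic → ℂ :=
    {g : (quasiSplit (↥(maximalRealSubfield L)) L (IsCMField.complexConj L) 3).Adelic | T < borelHeight g}.indicator Mf with hf₂
  have hφB' : ∀ b ∈ arithmeticBorel (↥(maximalRealSubfield L)) L (IsCMField.complexConj L) 3, ∀ x : (quasiSplit (↥(maximalRealSubfield L)) L (IsCMField.complexConj L) 3).Adelic,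
      φ ((b : (quasiSplit (↥(maximalRealSubfield L)) L (IsCMField.complexConj L) 3).Adelic) * x) = φ x := forall_arithmeticBorel_iff.2 hφB
  have hfB : ∀ b ∈ arithmeticBorel (↥(maximalRealSubfield L)) L (IsCMField.complexConj L) 3, ∀ x : (quasiSplit (↥(maximalRealSubfield L)) L (IsCMField.complexConj L) 3).Adelic,
      f ((b : (quasiSplit (↥(maximalRealSubfield L)) L (IsCMField.complexConj L) 3).Adelic) * x) = f x := fun b hb x => by
    simp only [hf, flatSectionU_apply, K2E1TruncatedEisensteinExplicit.borelHeight_arithmeticBorel_mul hb, hφB' b hb x]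
  have hEG : ∀ (γ : (quasiSplit (↥(maximalRealSubfield L)) L (IsCMField.complexConj L) 3).arithmeticSubgroup) (x : (quasiSplit (↥(maximalRealSubfield L)) L (IsCMField.complexConj L) 3).Adelic),
      eisensteinSeriesU f ((γ : (quasiSplit (↥(maximalRealSubfield L)) L (IsCMField.complexConj L) 3).Adelic) * x) = eisensteinSeriesU f x := fun γ x => eisensteinSeriesU_flatSectionU_arithmeticSubgroup_mul hφB z γ x
  have hCTB : ∀ b ∈ arithmeticBorel (↥(maximalRealSubfield L)) L (IsCMField.complexConj L) 3, ∀ x : (quasiSplit (↥(maximalRealSubfield L)) L (IsCMField.complexConj L) 3).Adelic,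
      borelConstantTerm ν 𝓕 (eisensteinSeriesU f) ((b : (quasiSplit (↥(maximalRealSubfield L)) L (IsCMField.complexConj L) 3).Adelic) * x) = borelConstantTerm ν 𝓕 (eisensteinSeriesU f) x := fun b hb x =>
    borelConstantTerm_rational_borel_mul_of_rational_invariant ν h𝓕N hEG b hb x
  have hMfB : ∀ b ∈ arithmeticBorel (↥(maximalRealSubfield L)) L (IsCMField.complexConj L) 3, ∀ x : (quasiSplit (↥(maximalRealSubfield L)) L (IsCMField.complexConj L) 3).Adelic,
      Mf ((b : (quasiSplit (↥(maximalRealSubfield L)) L (IsCMField.complexConj L) 3).Adelic) * x) = Mf x := fun b hb x => by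
    show borelConstantTerm ν 𝓕 (eisensteinSeriesU f) ((b : (quasiSplit (↥(maximalRealSubfield L)) L (IsCMField.complexConj L) 3).Adelic) * x) - f ((b : (quasiSplit (↥(maximalRealSubfield L)) L (IsCMField.complexConj L) 3).Adelic) * x) = borelConstantTerm ν 𝓕 (eisensteinSeriesU f) x - f x
    rw [hCTB b hb x, hfB b hb x]
  have hf₁B := forall_arithmeticBorel_indicator hfB fun h => h ≤ T
  have hCT : ∀ x : (quasiSplit (↥(maximalRealSubfield L)) L (IsCMField.complexConj L) 3).Adelic, T < borelHeight x →
      borelConstantTerm ν 𝓕 (eisensteinSeriesU f) x = f x + Mf x := fun x _ => (add_sub_cancel (f x) _).symm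
  have hsum : ∀ y : (quasiSplit (↥(maximalRealSubfield L)) L (IsCMField.complexConj L) 3).Adelic,
      Summable fun q : Quotient (orbitRel ↥(borelU ((IsCMField.complexConj L : L ≃ₐ[↥(maximalRealSubfield L)] L) : L →+* L) ((StdForm.antidiagonal 3).over L))
        ↥(unitaryGroupOfForm ((IsCMField.complexConj L : L ≃ₐ[↥(maximalRealSubfield L)] L) : L →+* L) ((StdForm.antidiagonal 3).over L))) =>
        f ((quasiSplit (↥(maximalRealSubfield L)) L (IsCMField.complexConj L) 3).toAdelic (q.out : ↥(unitaryGroupOfForm ((IsCMField.complexConj L : L ≃ₐ[↥(maximalRealSubfield L)] L) : L →+* L) ((StdForm.antidiagonal 3).over L))) * y) :=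
    fun y => (summable_eisensteinSeriesU_flatSectionU_cm_three L hz (φ := φ) (M := M) hφM y).of_norm
  -- (low) the domination constant through the real point `Re z`, and the SPHERICAL truncation bounded free there
  obtain ⟨C₁, hC₁, hmaj⟩ := exists_tsum_enorm_lowIndicator_le_cm_three L ν h𝓕N h𝓕c ((M : ℝ) : ℂ) hT hz
  have hzre : 2 < (((z.re : ℝ) : ℂ)).re := by rwa [Complex.ofReal_re]
  obtain ⟨M₁, hM₁⟩ := exists_bound_sub_borelConstantTerm_sphericalEisenstein_cm_three_free L ν h𝓕N h𝓕c hT ((M : ℝ) : ℂ) (isCompact_singleton (x := ((z.re : ℝ) : ℂ)))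
    (fun w hw => by rw [Set.mem_singleton_iff.1 hw]; exact hzre)
  obtain ⟨M₀, hM₀⟩ := exists_norm_truncation_eisensteinSeriesU_flatSectionU_le_cm_three L ν h𝓕N hT hzre continuous_const (M := ‖((M : ℝ) : ℂ)‖) (fun _ => le_rfl)
    (fun _ _ _ => rfl) (hM₁ _ (Set.mem_singleton _))
  -- (high) the tail is bounded above the floor ★ p863071 (`0 < 1 ≤ T`)
  obtain ⟨C', hC'⟩ := exists_bound_norm_borelConstantTerm_sub_flatSectionU_cm_three L ν h𝓕N h𝓕c hφc hφM hφN hφB hz (zero_lt_one.trans_le hT)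
  have hMfbd : ∀ g : (quasiSplit (↥(maximalRealSubfield L)) L (IsCMField.complexConj L) 3).Adelic, T < borelHeight g → ‖Mf g‖ ≤ max C' 0 := fun g hg =>
    (hC' g hg).trans (le_max_left _ _)
  refine ⟨(max (max M₀ M₁) 0 + C₁.toReal) + max C' 0, fun y => ?_⟩
  -- the low piece, dominated
  have hdom : ∀ x : (quasiSplit (↥(maximalRealSubfield L)) L (IsCMField.complexConj L) 3).Adelic, ‖f₁ x‖ₑ ≤
      ‖({g : (quasiSplit (↥(maximalRealSubfield L)) L (IsCMField.complexConj L) 3).Adelic | borelHeight g ≤ T}.indicator (flatSectionU (fun _ : (quasiSplit (↥(maximalRealSubfield L)) L (IsCMField.complexConj L) 3).Adelic => ((M : ℝ) : ℂ)) z)) x‖ₑ := fun x => by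
    by_cases hx : x ∈ {g : (quasiSplit (↥(maximalRealSubfield L)) L (IsCMField.complexConj L) 3).Adelic | borelHeight g ≤ T}
    · rw [hf₁, Set.indicator_of_mem hx, Set.indicator_of_mem hx, hf, flatSectionU_apply, flatSectionU_apply, ← ofReal_norm, ← ofReal_norm, norm_mul, norm_mul]
      refine ENNReal.ofReal_le_ofReal (mul_le_mul_of_nonneg_right ?_ (norm_nonneg _))
      calc ‖φ x‖ ≤ M := hφM x
        _ ≤ |M| := le_abs_self M
        _ = ‖((M : ℝ) : ℂ)‖ := by rw [Complex.norm_real, Real.norm_eq_abs]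
    · rw [hf₁, Set.indicator_of_notMem hx, Set.indicator_of_notMem hx]
  have hB0 : 0 ≤ max (max M₀ M₁) 0 := le_max_right _ _
  have h₁e : ‖eisensteinSeriesU f₁ y‖ₑ ≤ ENNReal.ofReal (max (max M₀ M₁) 0 + C₁.toReal) := by
    calc ‖eisensteinSeriesU f₁ y‖ₑ
        ≤ ∑' q : Quotient (QuotientGroup.rightRel (arithmeticBorel (↥(maximalRealSubfield L)) L (IsCMField.complexConj L) 3)),
            ‖f₁ (((q.out : (quasiSplit (↥(maximalRealSubfield L)) L (IsCMField.complexConj L) 3).arithmeticSubgroup) : (quasiSplit (↥(maximalRealSubfield L)) L (IsCMField.complexConj L) 3).Adelic) * y)‖ₑ := by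
          rw [eisensteinSeriesU_eq_tsum_arithmeticBorelQuot hf₁B y]
          exact enorm_tsum_le_tsum_enorm
      _ ≤ ‖truncation ν 𝓕 T (eisensteinSeriesU (flatSectionU (fun _ : (quasiSplit (↥(maximalRealSubfield L)) L (IsCMField.complexConj L) 3).Adelic => ((M : ℝ) : ℂ)) ((z.re : ℝ) : ℂ))) y‖ₑ + C₁ :=
          (ENNReal.tsum_le_tsum fun q => hdom _).trans (hmaj y)
      _ ≤ ENNReal.ofReal (max (max M₀ M₁) 0) + ENNReal.ofReal C₁.toReal := by
          refine add_le_add ?_ (by rw [ENNReal.ofReal_toReal hC₁.ne])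
          rw [← ofReal_norm]
          exact ENNReal.ofReal_le_ofReal ((hM₀ y).trans (le_max_left _ _))
      _ = ENNReal.ofReal (max (max M₀ M₁) 0 + C₁.toReal) := (ENNReal.ofReal_add hB0 ENNReal.toReal_nonneg).symm
  have h₁ : ‖eisensteinSeriesU f₁ y‖ ≤ max (max M₀ M₁) 0 + C₁.toReal := by
    rw [← ofReal_norm, ENNReal.ofReal_le_ofReal_iff (add_nonneg hB0 ENNReal.toReal_nonneg)] at h₁e
    exact h₁e
  -- the high piece, one coset above the floor
  have h₂ : ‖eisensteinSeriesU f₂ y‖ ≤ max C' 0 := norm_eisensteinSeriesU_indicator_lt_le siegel_three hT hMfB (le_max_right _ _) hMfbd y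
  -- the split
  rw [truncation_eisensteinSeriesU_eq_three (ν := ν) (𝓕 := 𝓕) hT hfB hMfB hCT (hsum y)]
  exact (norm_sub_le _ _).trans (add_le_add h₁ h₂)

/-- **THE SAME FOR A `(χ₁, χ₂)`-PAIR SECTION** `φ_ξ` (★ `IsChiSectionPair χ₁ χ₂ φ_ξ`, `χ₂` automorphic; continuous, `‖φ_ξ‖ ≤ M`; `1 ≤ T`, `2 < Re z`): `∃ M′, ∀ g, ‖Λ^T E(φ_ξ H^z)(g)‖ ≤ M′`, free — §1 with
★ `IsChiSectionPair.unipotent_mul` ∕ ★ `IsChiSectionPair.toAdelic_mul`. [cite: MoeglinWaldspurger1995, I.2.13, II.1.7] [cite: Rogawski1990, §13.9 p. 229] -/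
theorem exists_norm_truncation_eisensteinSeriesU_flatSectionU_le_pair_cm_three_free
    (ν : Measure ↥(adelicUnipotent (↥(maximalRealSubfield L)) L (IsCMField.complexConj L) 3)) [ν.IsHaarMeasure]
    {𝓕 : Set ↥(adelicUnipotent (↥(maximalRealSubfield L)) L (IsCMField.complexConj L) 3)}
    (h𝓕N : IsFundamentalDomain ↥(rationalUnipotent (↥(maximalRealSubfield L)) L (IsCMField.complexConj L) 3) 𝓕 ν) (h𝓕c : IsCompact (closure 𝓕))
    {χ₁ : HeckeCharacter L} {χ₂ : ↥(TorusDict.torus (IsCMField.complexConj L)) →ₜ* ℂˣ} (hχ₂ : TorusDict.IsAutomorphic (IsCMField.complexConj L) χ₂)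
    {φξ : (quasiSplit (↥(maximalRealSubfield L)) L (IsCMField.complexConj L) 3).Adelic → ℂ} (hφξ : IsChiSectionPair χ₁ χ₂ φξ) (hφc : Continuous φξ) {M : ℝ} (hφM : ∀ x, ‖φξ x‖ ≤ M)
    {T : ℝ≥0} (hT : 1 ≤ T) {z : ℂ} (hz : 2 < z.re) :
    ∃ M' : ℝ, ∀ g : (quasiSplit (↥(maximalRealSubfield L)) L (IsCMField.complexConj L) 3).Adelic, ‖truncation ν 𝓕 T (eisensteinSeriesU (flatSectionU φξ z)) g‖ ≤ M' :=
  exists_norm_truncation_eisensteinSeriesU_flatSectionU_le_level_cm_three_free L ν h𝓕N h𝓕c hφc hφM hφξ.unipotent_mul (hφξ.toAdelic_mul hχ₂) hT hz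

end Bound

/-! ## §2 `Λ^T E(φH^z) ∈ L^p(X, μ)` for every finite `μ`, free; the spherical (Tr) letter of the tube seed, free -/

section LTwo

/-- **`Λ^T E(φH^z) ∈ L^p(X, μ)`, FREE**, for every finite measure `μ` on the automorphic quotient and every `p` (`φ` continuous, bounded, left-`N(𝔸)`∕`B(L⁺)`-invariant; `1 ≤ T`; `2 < Re z`):
★ R6e `memLp_quotFun_of_bound` with §1's bound, Borel descent ★ `measurable_quotFun_of_measurable` of ★ `hΛm`∕`hΛG`. [cite: MoeglinWaldspurger1995, I.2.13 and IV.2] -/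
theorem memLp_quotFun_truncation_eisensteinSeriesU_flatSectionU_level_cm_three_free
    (ν : Measure ↥(adelicUnipotent (↥(maximalRealSubfield L)) L (IsCMField.complexConj L) 3)) [ν.IsHaarMeasure]
    {𝓕 : Set ↥(adelicUnipotent (↥(maximalRealSubfield L)) L (IsCMField.complexConj L) 3)}
    (h𝓕N : IsFundamentalDomain ↥(rationalUnipotent (↥(maximalRealSubfield L)) L (IsCMField.complexConj L) 3) 𝓕 ν) (h𝓕c : IsCompact (closure 𝓕))
    {φ : (quasiSplit (↥(maximalRealSubfield L)) L (IsCMField.complexConj L) 3).Adelic → ℂ} (hφc : Continuous φ) {M : ℝ} (hφM : ∀ x, ‖φ x‖ ≤ M)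
    (hφN : ∀ (u : ↥(adelicUnipotent (↥(maximalRealSubfield L)) L (IsCMField.complexConj L) 3)) (x : (quasiSplit (↥(maximalRealSubfield L)) L (IsCMField.complexConj L) 3).Adelic),
      φ ((u : (quasiSplit (↥(maximalRealSubfield L)) L (IsCMField.complexConj L) 3).Adelic) * x) = φ x)
    (hφB : ∀ b ∈ borelU ((IsCMField.complexConj L : L ≃ₐ[↥(maximalRealSubfield L)] L) : L →+* L) ((StdForm.antidiagonal 3).over L),
      ∀ x : (quasiSplit (↥(maximalRealSubfield L)) L (IsCMField.complexConj L) 3).Adelic,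
        φ ((quasiSplit (↥(maximalRealSubfield L)) L (IsCMField.complexConj L) 3).toAdelic b * x) = φ x)
    {T : ℝ≥0} (hT : 1 ≤ T) {z : ℂ} (hz : 2 < z.re)
    (μ : Measure (quasiSplit (↥(maximalRealSubfield L)) L (IsCMField.complexConj L) 3).automorphicQuotient) [IsFiniteMeasure μ] (p : ℝ≥0∞) :
    MemLp ((quasiSplit (↥(maximalRealSubfield L)) L (IsCMField.complexConj L) 3).quotFun (truncation ν 𝓕 T (eisensteinSeriesU (flatSectionU φ z)))) p μ := by
  obtain ⟨M', hM'⟩ := exists_norm_truncation_eisensteinSeriesU_flatSectionU_le_level_cm_three_free L ν h𝓕N h𝓕c hφc hφM hφN hφB hT hz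
  exact memLp_quotFun_of_bound _ μ p hM'
    (measurable_quotFun_of_measurable (measurable_truncation_eisensteinSeriesU_flatSectionU_cm_three' L ν 𝓕 hT hz hφc hφM)
      (truncation_eisensteinSeriesU_flatSectionU_arithmeticSubgroup_mul ν h𝓕N T hφB z)).aestronglyMeasurable

/-- **THE SPHERICAL (Tr) LETTER, FREE**: `∀ σ : ℝ, 2 < σ → Λ^T E((M:ℂ)H^σ) ∈ L²(X, μ)` for every finite `μ` and `1 ≤ T` — the binder `hTr` of ★ p863045 `tubeSeed_pair_cm_three_of_letters` ∕
`tubeSeed_level_cm_three_of_letters` token for token (§2 at the constant section). [cite: MoeglinWaldspurger1995, I.2.13 and IV.2] -/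
theorem hTr_cm_three_free
    (ν : Measure ↥(adelicUnipotent (↥(maximalRealSubfield L)) L (IsCMField.complexConj L) 3)) [ν.IsHaarMeasure]
    {𝓕 : Set ↥(adelicUnipotent (↥(maximalRealSubfield L)) L (IsCMField.complexConj L) 3)}
    (h𝓕N : IsFundamentalDomain ↥(rationalUnipotent (↥(maximalRealSubfield L)) L (IsCMField.complexConj L) 3) 𝓕 ν) (h𝓕c : IsCompact (closure 𝓕))
    (M : ℝ) {T : ℝ≥0} (hT : 1 ≤ T)
    (μ : Measure (quasiSplit (↥(maximalRealSubfield L)) L (IsCMField.complexConj L) 3).automorphicQuotient) [IsFiniteMeasure μ] :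
    ∀ σ : ℝ, 2 < σ → MemLp ((quasiSplit (↥(maximalRealSubfield L)) L (IsCMField.complexConj L) 3).quotFun
      (truncation ν 𝓕 T (eisensteinSeriesU (flatSectionU (fun _ : (quasiSplit (↥(maximalRealSubfield L)) L (IsCMField.complexConj L) 3).Adelic => ((M : ℝ) : ℂ)) ((σ : ℝ) : ℂ))))) 2 μ :=
  fun σ hσ => memLp_quotFun_truncation_eisensteinSeriesU_flatSectionU_level_cm_three_free L ν h𝓕N h𝓕c continuous_const (M := ‖((M : ℝ) : ℂ)‖) (fun _ => le_rfl)
    (fun _ _ => rfl) (fun _ _ _ => rfl) hT (by rwa [Complex.ofReal_re]) μ 2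

end LTwo

/-! ## §3 HEAD (ED. 3 of ★ «CM-FINAL»): the Maass–Selberg relation for flat sections of `U(J₃)` at the CM pair WITHOUT the decay letter `hdec′` -/

section MaassSelberg

variable [MeasurableSpace (AdeleRing (𝓞 L) L)ˣ] [BorelSpace (AdeleRing (𝓞 L) L)ˣ]

/-- **THE MAASS–SELBERG RELATION FOR FLAT SECTIONS OF `U(J₃)` AT THE CM PAIR, ED. 3 — NO DECAY LETTER.**  ★ ED. 2 `maassSelberg_flatSectionU_cm_three_final'` VERBATIM with the binder
`hdec′` (`‖E(f′_{z′}) − E(f′_{z′})_B‖ ≤ M₁` on `{H > T}`) DELETED and nothing added: ED. 2 used it only to bound `Λ^T E(f′_{z′})` (★ p857707), and that bound is FREE (§1, domination).  NAMED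
INPUTS EXACTLY the `K_U`-average data `hΞ₁…hΞ₄` (the consumer's torus-character datum); conclusion verbatim; proof = ED. 2's body (★ ED. 7 `maassSelberg_flatSectionU_three_pair`, Godement ★,
Borel ∕ `G(L⁺)`-invariance ★, `hEint` ★) with `hΛbdd` from §1. [cite: MoeglinWaldspurger1995, II.1.5–II.1.7 and IV.2.1–IV.2.3] [cite: Arthur1980TraceFormulaII, §4] [cite: Garrett2018, §11.3] -/
theorem maassSelberg_flatSectionU_cm_three_final_free
    (μ : Measure (quasiSplit (↥(maximalRealSubfield L)) L (IsCMField.complexConj L) 3).automorphicQuotient) [(quasiSplit (↥(maximalRealSubfield L)) L (IsCMField.complexConj L) 3).IsAutomorphicMeasure μ]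
    (νG : Measure (quasiSplit (↥(maximalRealSubfield L)) L (IsCMField.complexConj L) 3).Adelic) [νG.IsHaarMeasure] [νG.IsInvInvariant]
    (μK : Measure ((standardMaximalCompactGL 3 L).comap (adelicVal (↥(maximalRealSubfield L)) L (IsCMField.complexConj L) 3 ((StdForm.antidiagonal 3).over L)) : Subgroup (quasiSplit (↥(maximalRealSubfield L)) L (IsCMField.complexConj L) 3).Adelic))
    [μK.IsHaarMeasure]
    (νI : Measure (AdeleRing (𝓞 L) L)ˣ) [νI.IsHaarMeasure]
    {𝓕I : Set (AdeleRing (𝓞 L) L)ˣ} (h𝓕I : IsIdeleClassDomain L 𝓕I)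
    (ν : Measure ↥(adelicUnipotent (↥(maximalRealSubfield L)) L (IsCMField.complexConj L) 3)) [ν.IsHaarMeasure] [ν.IsInvInvariant]
    {𝓕 : Set ↥(adelicUnipotent (↥(maximalRealSubfield L)) L (IsCMField.complexConj L) 3)} (h𝓕N : IsFundamentalDomain ↥(rationalUnipotent (↥(maximalRealSubfield L)) L (IsCMField.complexConj L) 3) 𝓕 ν) (h𝓕1 : ν 𝓕 = 1) (h𝓕c : IsCompact (closure 𝓕)) :
    ∃ cμ K : ℝ, 0 < cμ ∧ 0 < K ∧
      ∀ {β : (quasiSplit (↥(maximalRealSubfield L)) L (IsCMField.complexConj L) 3).Adelic → ℝ≥0∞}, IsCoveringWeight ((arithmeticBorel (↥(maximalRealSubfield L)) L (IsCMField.complexConj L) 3).map (quasiSplit (↥(maximalRealSubfield L)) L (IsCMField.complexConj L) 3).arithmeticSubgroup.subtype) β →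
      ∀ {T : ℝ≥0}, 1 ≤ T →
      ∀ {φ φ' : (quasiSplit (↥(maximalRealSubfield L)) L (IsCMField.complexConj L) 3).Adelic → ℂ},
      Continuous φ →
        (∀ (n : unipotentInBorel (↥(maximalRealSubfield L)) L (IsCMField.complexConj L) 3) (y : (quasiSplit (↥(maximalRealSubfield L)) L (IsCMField.complexConj L) 3).Adelic), φ (((n : borelAdelic (↥(maximalRealSubfield L)) L (IsCMField.complexConj L) 3) : (quasiSplit (↥(maximalRealSubfield L)) L (IsCMField.complexConj L) 3).Adelic) * y) = φ y) →
        (∀ b ∈ arithmeticBorel (↥(maximalRealSubfield L)) L (IsCMField.complexConj L) 3, ∀ y : (quasiSplit (↥(maximalRealSubfield L)) L (IsCMField.complexConj L) 3).Adelic, φ ((b : (quasiSplit (↥(maximalRealSubfield L)) L (IsCMField.complexConj L) 3).Adelic) * y) = φ y) →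
      ∀ {Cφ : ℝ}, (∀ x, ‖φ x‖ ≤ Cφ) →
      Continuous φ' →
        (∀ (n : unipotentInBorel (↥(maximalRealSubfield L)) L (IsCMField.complexConj L) 3) (y : (quasiSplit (↥(maximalRealSubfield L)) L (IsCMField.complexConj L) 3).Adelic), φ' (((n : borelAdelic (↥(maximalRealSubfield L)) L (IsCMField.complexConj L) 3) : (quasiSplit (↥(maximalRealSubfield L)) L (IsCMField.complexConj L) 3).Adelic) * y) = φ' y) →
        (∀ b ∈ arithmeticBorel (↥(maximalRealSubfield L)) L (IsCMField.complexConj L) 3, ∀ y : (quasiSplit (↥(maximalRealSubfield L)) L (IsCMField.complexConj L) 3).Adelic, φ' ((b : (quasiSplit (↥(maximalRealSubfield L)) L (IsCMField.complexConj L) 3).Adelic) * y) = φ' y) →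
      ∀ {Cφ' : ℝ}, (∀ x, ‖φ' x‖ ≤ Cφ') →
      ∀ {z z' : ℂ}, 2 < z'.re → z'.re < z.re →
      -- NAMED: the `K_U`-averages `hΞ₁…hΞ₄` — NOTHING ELSE (ED. 1∕2's decay letter `hdec′` is DISCHARGED inside: `hΛbdd` by domination, §1)
      ∀ {Ξ₁ Ξ₂ Ξ₃ Ξ₄ : (AdeleRing (𝓞 L) L)ˣ → ℂ},
      Measurable Ξ₁ → ∀ {CΞ₁ : ℝ}, (∀ x, ‖Ξ₁ x‖ ≤ CΞ₁) → (∀ k ∈ GaloisRepresentations.principalIdeles L, ∀ x, Ξ₁ (k * x) = Ξ₁ x) →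
        (∀ (r : ℝ≥0ˣ) (x : (AdeleRing (𝓞 L) L)ˣ), Ξ₁ (posRealIdele L r * x) = Ξ₁ x) →
        (∀ t : torusInBorel (↥(maximalRealSubfield L)) L (IsCMField.complexConj L) 3,
          ∫ k, φ (((t : borelAdelic (↥(maximalRealSubfield L)) L (IsCMField.complexConj L) 3) : (quasiSplit (↥(maximalRealSubfield L)) L (IsCMField.complexConj L) 3).Adelic) * (k : (quasiSplit (↥(maximalRealSubfield L)) L (IsCMField.complexConj L) 3).Adelic)) *
              conj (φ' (((t : borelAdelic (↥(maximalRealSubfield L)) L (IsCMField.complexConj L) 3) : (quasiSplit (↥(maximalRealSubfield L)) L (IsCMField.complexConj L) 3).Adelic) * (k : (quasiSplit (↥(maximalRealSubfield L)) L (IsCMField.complexConj L) 3).Adelic))) ∂μK = Ξ₁ (diagUnit (t : borelAdelic (↥(maximalRealSubfield L)) L (IsCMField.complexConj L) 3).2 0)) →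
      Measurable Ξ₂ → ∀ {CΞ₂ : ℝ}, (∀ x, ‖Ξ₂ x‖ ≤ CΞ₂) → (∀ k ∈ GaloisRepresentations.principalIdeles L, ∀ x, Ξ₂ (k * x) = Ξ₂ x) →
        (∀ (r : ℝ≥0ˣ) (x : (AdeleRing (𝓞 L) L)ˣ), Ξ₂ (posRealIdele L r * x) = Ξ₂ x) →
        (∀ t : torusInBorel (↥(maximalRealSubfield L)) L (IsCMField.complexConj L) 3,
          ∫ k, φ (((t : borelAdelic (↥(maximalRealSubfield L)) L (IsCMField.complexConj L) 3) : (quasiSplit (↥(maximalRealSubfield L)) L (IsCMField.complexConj L) 3).Adelic) * (k : (quasiSplit (↥(maximalRealSubfield L)) L (IsCMField.complexConj L) 3).Adelic)) *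
              conj ((fun g : (quasiSplit (↥(maximalRealSubfield L)) L (IsCMField.complexConj L) 3).Adelic => (∫ v : ↥(adelicUnipotent (↥(maximalRealSubfield L)) L (IsCMField.complexConj L) 3), flatSectionU φ' z' ((quasiSplit (↥(maximalRealSubfield L)) L (IsCMField.complexConj L) 3).toAdelic (weylLongU ((IsCMField.complexConj L : L ≃ₐ[↥(maximalRealSubfield L)] L) : L →+* L) (rfl : (StdForm.antidiagonal 3).over L = (StdForm.antidiagonal 3).over L)) * ((v : (quasiSplit (↥(maximalRealSubfield L)) L (IsCMField.complexConj L) 3).Adelic) * g)) ∂ν) * ((borelHeight g : ℝ) : ℂ) ^ (z' - 2)) (((t : borelAdelic (↥(maximalRealSubfield L)) L (IsCMField.complexConj L) 3) : (quasiSplit (↥(maximalRealSubfield L)) L (IsCMField.complexConj L) 3).Adelic) * (k : (quasiSplit (↥(maximalRealSubfield L)) L (IsCMField.complexConj L) 3).Adelic))) ∂μK = Ξ₂ (diagUnit (t : borelAdelic (↥(maximalRealSubfield L)) L (IsCMField.complexConj L) 3).2 0)) →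
      Measurable Ξ₃ → ∀ {CΞ₃ : ℝ}, (∀ x, ‖Ξ₃ x‖ ≤ CΞ₃) → (∀ k ∈ GaloisRepresentations.principalIdeles L, ∀ x, Ξ₃ (k * x) = Ξ₃ x) →
        (∀ (r : ℝ≥0ˣ) (x : (AdeleRing (𝓞 L) L)ˣ), Ξ₃ (posRealIdele L r * x) = Ξ₃ x) →
        (∀ t : torusInBorel (↥(maximalRealSubfield L)) L (IsCMField.complexConj L) 3,
          ∫ k, (fun g : (quasiSplit (↥(maximalRealSubfield L)) L (IsCMField.complexConj L) 3).Adelic => (∫ v : ↥(adelicUnipotent (↥(maximalRealSubfield L)) L (IsCMField.complexConj L) 3), flatSectionU φ z ((quasiSplit (↥(maximalRealSubfield L)) L (IsCMField.complexConj L) 3).toAdelic (weylLongU ((IsCMField.complexConj L : L ≃ₐ[↥(maximalRealSubfield L)] L) : L →+* L) (rfl : (StdForm.antidiagonal 3).over L = (StdForm.antidiagonal 3).over L)) * ((v : (quasiSplit (↥(maximalRealSubfield L)) L (IsCMField.complexConj L) 3).Adelic) * g)) ∂ν) * ((borelHeight g : ℝ) : ℂ) ^ (z - 2)) (((t : borelAdelic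 (↥(maximalRealSubfield L)) L (IsCMField.complexConj L) 3) : (quasiSplit (↥(maximalRealSubfield L)) L (IsCMField.complexConj L) 3).Adelic) * (k : (quasiSplit (↥(maximalRealSubfield L)) L (IsCMField.complexConj L) 3).Adelic)) *
              conj (φ' (((t : borelAdelic (↥(maximalRealSubfield L)) L (IsCMField.complexConj L) 3) : (quasiSplit (↥(maximalRealSubfield L)) L (IsCMField.complexConj L) 3).Adelic) * (k : (quasiSplit (↥(maximalRealSubfield L)) L (IsCMField.complexConj L) 3).Adelic))) ∂μK = Ξ₃ (diagUnit (t : borelAdelic (↥(maximalRealSubfield L)) L (IsCMField.complexConj L) 3).2 0)) →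
      Measurable Ξ₄ → ∀ {CΞ₄ : ℝ}, (∀ x, ‖Ξ₄ x‖ ≤ CΞ₄) → (∀ k ∈ GaloisRepresentations.principalIdeles L, ∀ x, Ξ₄ (k * x) = Ξ₄ x) →
        (∀ (r : ℝ≥0ˣ) (x : (AdeleRing (𝓞 L) L)ˣ), Ξ₄ (posRealIdele L r * x) = Ξ₄ x) →
        (∀ t : torusInBorel (↥(maximalRealSubfield L)) L (IsCMField.complexConj L) 3,
          ∫ k, (fun g : (quasiSplit (↥(maximalRealSubfield L)) L (IsCMField.complexConj L) 3).Adelic => (∫ v : ↥(adelicUnipotent (↥(maximalRealSubfield L)) L (IsCMField.complexConj L) 3), flatSectionU φ z ((quasiSplit (↥(maximalRealSubfield L)) L (IsCMField.complexConj L) 3).toAdelic (weylLongU ((IsCMField.complexConj L : L ≃ₐ[↥(maximalRealSubfield L)] L) : L →+* L) (rfl : (StdForm.antidiagonal 3).over L = (StdForm.antidiagonal 3).over L)) * ((v : (quasiSplit (↥(maximalRealSubfield L)) L (IsCMField.complexConj L) 3).Adelic) * g)) ∂ν) * ((borelHeight g : ℝ) : ℂ) ^ (z - 2)) (((t : borelAdelic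 (↥(maximalRealSubfield L)) L (IsCMField.complexConj L) 3) : (quasiSplit (↥(maximalRealSubfield L)) L (IsCMField.complexConj L) 3).Adelic) * (k : (quasiSplit (↥(maximalRealSubfield L)) L (IsCMField.complexConj L) 3).Adelic)) *
              conj ((fun g : (quasiSplit (↥(maximalRealSubfield L)) L (IsCMField.complexConj L) 3).Adelic => (∫ v : ↥(adelicUnipotent (↥(maximalRealSubfield L)) L (IsCMField.complexConj L) 3), flatSectionU φ' z' ((quasiSplit (↥(maximalRealSubfield L)) L (IsCMField.complexConj L) 3).toAdelic (weylLongU ((IsCMField.complexConj L : L ≃ₐ[↥(maximalRealSubfield L)] L) : L →+* L) (rfl : (StdForm.antidiagonal 3).over L = (StdForm.antidiagonal 3).over L)) * ((v : (quasiSplit (↥(maximalRealSubfield L)) L (IsCMField.complexConj L) 3).Adelic) * g)) ∂ν) * ((borelHeight g : ℝ) : ℂ) ^ (z' - 2)) (((t : borelAdelic (↥(maximalRealSubfield L)) L (IsCMField.complexConj L) 3) : (quasiSplit (↥(maximalRealSubfield L)) L (IsCMField.complexConj L) 3).Adelic) * (k : (quasiSplit (↥(maximalRealSubfield L)) L (IsCMField.complexConj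 L) 3).Adelic))) ∂μK = Ξ₄ (diagUnit (t : borelAdelic (↥(maximalRealSubfield L)) L (IsCMField.complexConj L) 3).2 0)) →
        ∫ x, (quasiSplit (↥(maximalRealSubfield L)) L (IsCMField.complexConj L) 3).quotFun (truncation ν 𝓕 T (eisensteinSeriesU (flatSectionU φ z))) x * conj ((quasiSplit (↥(maximalRealSubfield L)) L (IsCMField.complexConj L) 3).quotFun (truncation ν 𝓕 T (eisensteinSeriesU (flatSectionU φ' z'))) x) ∂μ =
          (cμ : ℂ) * ((K : ℂ) *
            ((((T : ℝ) : ℂ) ^ (z + conj z' - 2) / (z + conj z' - 2)) * (∫ x in {x : (AdeleRing (𝓞 L) L)ˣ | (IdeleClassGroup.ideleNorm L x : ℝ) ≤ 1} ∩ 𝓕I, ((IdeleClassGroup.ideleNorm L x : ℝ) : ℂ) * Ξ₁ x ∂νI)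
              + (((T : ℝ) : ℂ) ^ (z - conj z') / (z - conj z')) * (∫ x in {x : (AdeleRing (𝓞 L) L)ˣ | (IdeleClassGroup.ideleNorm L x : ℝ) ≤ 1} ∩ 𝓕I, ((IdeleClassGroup.ideleNorm L x : ℝ) : ℂ) * Ξ₂ x ∂νI)
              - (((T : ℝ) : ℂ) ^ (-(z - conj z')) / (z - conj z')) * (∫ x in {x : (AdeleRing (𝓞 L) L)ˣ | (IdeleClassGroup.ideleNorm L x : ℝ) ≤ 1} ∩ 𝓕I, ((IdeleClassGroup.ideleNorm L x : ℝ) : ℂ) * Ξ₃ x ∂νI)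
              - (((T : ℝ) : ℂ) ^ (-(z + conj z' - 2)) / (z + conj z' - 2)) * (∫ x in {x : (AdeleRing (𝓞 L) L)ˣ | (IdeleClassGroup.ideleNorm L x : ℝ) ≤ 1} ∩ 𝓕I, ((IdeleClassGroup.ideleNorm L x : ℝ) : ℂ) * Ξ₄ x ∂νI))) := by
  haveI := t2Space_adeleRing_of_numberField L
  haveI : T2Space (quasiSplit (↥(maximalRealSubfield L)) L (IsCMField.complexConj L) 3).Adelic := inferInstanceAs (T2Space (adelic (↥(maximalRealSubfield L)) L (IsCMField.complexConj L) 3 ((StdForm.antidiagonal 3).over L)))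
  obtain ⟨cμ, K, hcμ, hK, h7⟩ := maassSelberg_flatSectionU_three_pair (Algebra.IsQuadraticExtension.finrank_eq_two (↥(maximalRealSubfield L)) L)
    (AlgEquiv.ext fun x => IsCMField.complexConj_apply_apply L x) (IsCMField.complexConj_ne_one L) μ νG μK νI
    (exists_mem_borelAdelic_mul_mem_standardMaximalCompactGL_cm_three L) h𝓕I ν h𝓕N h𝓕1
  refine ⟨cμ, K, hcμ, hK, ?_⟩
  intro β hβ T hT φ φ' hφc hφN hφB Cφ hφC hφ'c hφ'N hφ'B Cφ' hφ'C z z' hz' hzz'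
    Ξ₁ Ξ₂ Ξ₃ Ξ₄ hΞ₁m CΞ₁ hΞ₁C hΞ₁K hΞ₁M hΞ₁ hΞ₂m CΞ₂ hΞ₂C hΞ₂K hΞ₂M hΞ₂ hΞ₃m CΞ₃ hΞ₃C hΞ₃K hΞ₃M hΞ₃ hΞ₄m CΞ₄ hΞ₄C hΞ₄K hΞ₄M hΞ₄
  have hz : 2 < z.re := hz'.trans hzz'
  -- the Godement finiteness of the standard sections `H^w`, `Re w > 2`, at every `g` (★ `hfin_of_locallyUniformMajorant` + ★ R4a majorant, `𝓕` of compact closure)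
  have hstdB : ∀ w : ℂ, ∀ b ∈ borelU ((IsCMField.complexConj L : L ≃ₐ[↥(maximalRealSubfield L)] L) : L →+* L) ((StdForm.antidiagonal 3).over L), ∀ x : (quasiSplit (↥(maximalRealSubfield L)) L (IsCMField.complexConj L) 3).Adelic,
      flatSectionU (fun _ : (quasiSplit (↥(maximalRealSubfield L)) L (IsCMField.complexConj L) 3).Adelic => (1 : ℂ)) w ((quasiSplit (↥(maximalRealSubfield L)) L (IsCMField.complexConj L) 3).toAdelic b * x) = flatSectionU (fun _ : (quasiSplit (↥(maximalRealSubfield L)) L (IsCMField.complexConj L) 3).Adelic => (1 : ℂ)) w x :=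
    fun w => forall_arithmeticBorel_iff.1 fun b hb x => by rw [flatSectionU_apply, flatSectionU_apply, K2E1TruncatedEisensteinExplicit.borelHeight_arithmeticBorel_mul hb]
  have hfin : ∀ {w : ℂ}, 2 < w.re → ∀ g : (quasiSplit (↥(maximalRealSubfield L)) L (IsCMField.complexConj L) 3).Adelic, ∫⁻ u in 𝓕, (∑' q : (quasiSplit (↥(maximalRealSubfield L)) L (IsCMField.complexConj L) 3).quotientSubgroup ⧸ (borelAdelic (↥(maximalRealSubfield L)) L (IsCMField.complexConj L) 3).subgroupOf (quasiSplit (↥(maximalRealSubfield L)) L (IsCMField.complexConj L) 3).quotientSubgroup,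
      ‖flatSectionU (fun _ : (quasiSplit (↥(maximalRealSubfield L)) L (IsCMField.complexConj L) 3).Adelic => (1 : ℂ)) w ((((q.out : (quasiSplit (↥(maximalRealSubfield L)) L (IsCMField.complexConj L) 3).quotientSubgroup) : (quasiSplit (↥(maximalRealSubfield L)) L (IsCMField.complexConj L) 3).Adelic))⁻¹ * (u : (quasiSplit (↥(maximalRealSubfield L)) L (IsCMField.complexConj L) 3).Adelic) * g)‖ₑ) ∂ν < ∞ :=
    fun {w} hw g => hfin_of_locallyUniformMajorant ν (hstdB w) (fun q => (continuous_flatSectionU continuous_const w).comp (continuous_const.mul continuous_id))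
      (exists_locallyUniform_majorant_flatSectionU_cm_three L hw (M := 1) (fun x => by rw [norm_one])) h𝓕c g
  -- `Λ′`: Borel, `G(L⁺)`-invariant (★ p857707) and bounded FREE (§1, domination)
  obtain ⟨M₀, hΛbdd⟩ := exists_norm_truncation_eisensteinSeriesU_flatSectionU_le_level_cm_three_free L ν h𝓕N h𝓕c hφ'c hφ'C
    (fun u y => hφ'N ⟨⟨(u : (quasiSplit (↥(maximalRealSubfield L)) L (IsCMField.complexConj L) 3).Adelic), adelicUnipotent_le_borelAdelic u.2⟩, (mem_unipotentInBorel_iff _).2 u.2⟩ y)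
    (forall_arithmeticBorel_iff.1 hφ'B) hT hz'
  exact h7 hβ hT hφc.measurable hφN hφB hφC hφ'c.measurable hφ'N hφ'B hφ'C hz' hzz' (hfin hz) (hfin hz') (fun g => summable_flatSectionU_cm_three L hz hφC g)
    (measurable_truncation_eisensteinSeriesU_flatSectionU_cm_three' L ν 𝓕 hT hz' hφ'c hφ'C)
    (truncation_eisensteinSeriesU_flatSectionU_arithmeticSubgroup_mul ν h𝓕N T (forall_arithmeticBorel_iff.1 hφ'B) z') hΛbdd
    (fun g => integrableOn_translate_of_continuous (adelicUnipotent (↥(maximalRealSubfield L)) L (IsCMField.complexConj L) 3) ν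
      (continuous_eisensteinSeriesU_flatSectionU_cm_three L hz' hφ'c hφ'C) h𝓕c g)
    hΞ₁m hΞ₁C hΞ₁K hΞ₁M hΞ₁ hΞ₂m hΞ₂C hΞ₂K hΞ₂M hΞ₂ hΞ₃m hΞ₃C hΞ₃K hΞ₃M hΞ₃ hΞ₄m hΞ₄C hΞ₄K hΞ₄M hΞ₄


end MaassSelberg

end Summit.HodgeConjecture.HodgeConjecture.Cruxes.H413.K2E1ChiTruncatedEisensteinBoundedCMThree

end
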